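import Mathlib.Topology.Algebra.Module.FiniteDimension
import Mathlib.Analysis.LocallyConvex.AbsConvexOpen
import Mathlib.Analysis.RCLike.Lemmas
import Literature.Analysis.FunctionSpaces.NuclearSpace
import Literature.Analysis.FunctionSpaces.NuclearDominated
import HarnessLib

/-!
# Nuclear spaces: finite-dimensional spaces, products and subspaces (proofs)

Discharges of the elementary named facts of
`Literature/Analysis/FunctionSpaces/NuclearSpace.lean` on Pietsch's seminorm form of nuclearity
(`Literature.Analysis.FunctionSpaces.NuclearSpace`), via the permanence lemmas of `NuclearDominated`:

* `Literature.Analysis.FunctionSpaces.NuclearSpace.of_finiteDimensional_holds` — a finite-dimensional Hausdorff topological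
  vector space over `𝕜 = ℝ, ℂ` is nuclear: `p(x) ≤ ∑ᵢ |bᵢ*(x)| p(bᵢ)` for a basis `bᵢ` with (here
  automatically continuous) coordinate functionals `bᵢ*` (Pietsch 1972, Prop. 4.1.4; Trèves 1967,
  §50, Example after Def. 50.1);
* `Literature.Analysis.FunctionSpaces.NuclearSpace.prod_holds` — the product of two nuclear spaces is nuclear:
  `p(x, y) ≤ p(x, 0) + p(0, y)` and both summands are pull-backs of continuous seminorms of the
  factors (Pietsch 1972, Prop. 5.2.1);
* `Literature.Analysis.FunctionSpaces.not_nuclearSpace_of_not_finiteDimensional_holds` — an infinite-dimensional normed space is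
  not nuclear (Trèves 1967, Cor. 2 of Prop. 50.2; Pietsch 1972, Thm. 4.4.14): if the norm is
  dominated by a nuclear seminorm `∑ₙ |φₙ|`, `|φₙ| ≤ cₙ q ≤ cₙ M ‖·‖`, then cutting the series where
  `M ∑_{n ≥ N} cₙ ≤ ½` gives `‖x‖ ≤ 2 ∑_{n < N} |φₙ(x)|`, so `x ↦ (φₙ(x))_{n < N}` is an injective
  linear map into `𝕜^N` and `E` is finite dimensional.
* `Literature.Analysis.FunctionSpaces.NuclearSpace.of_closed_submodule_holds` — every linear
  subspace of a locally convex nuclear space is nuclear (Pietsch 1972, Prop. 5.1.1): a continuous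
  seminorm of the subspace is bounded by the restriction of a continuous seminorm of the ambient
  space (local convexity, via Mathlib's `PolynormableSpace` and
  `Seminorm.exists_le_comp_of_isInducing`), and nuclear dominations restrict. The bridge
  `Literature.Analysis.FunctionSpaces.locallyConvexSpace_rclike_of_real` turns the real local
  convexity hypothesis of the fact into Mathlib's `LocallyConvexSpace 𝕜 E` (`RCLike`,
  `ComplexOrder`).

## References

* A. Pietsch, *Nuclear locally convex spaces*, Ergebnisse 66, Springer (1972), Prop. 4.1.4,
  Thm. 4.4.14 (a nuclear normed space is finite dimensional), Prop. 5.1.1 (subspaces),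
  Prop. 5.2.1.
* F. Trèves, *Topological vector spaces, distributions and kernels* (1967), §50 (Example after
  Def. 50.1; Cor. 2 of Prop. 50.2).
-/

open scoped NNReal

namespace Literature.Analysis.FunctionSpaces

namespace NuclearSpace

variable {𝕜 : Type*} {E : Type*} [RCLike 𝕜] [AddCommGroup E] [Module 𝕜 E] [TopologicalSpace E]

/-- Discharge of the named fact `Literature.Analysis.FunctionSpaces.NuclearSpace.of_finiteDimensional`: **a finite-dimensional
Hausdorff topological vector space is nuclear.** With a basis `bᵢ` and its coordinate functionals
`bᵢ*` (continuous, `LinearMap.toContinuousLinearMap`), every seminorm satisfies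
`p(x) ≤ ∑ᵢ p(bᵢ) |bᵢ*(x)|`, a nuclear seminorm with finitely many terms dominated by the continuous
seminorm `q = ∑ᵢ |bᵢ*|`. Trèves 1967, §50, Example after Def. 50.1; Pietsch 1972, Prop. 4.1.4.
[cite: Treves1967, §50 Example after Def. 50.1] [cite: Pietsch1972, Prop. 4.1.4] -/
theorem of_finiteDimensional_holds : of_finiteDimensional (𝕜 := 𝕜) (E := E) := by
  intro _ _ _ _
  refine ⟨fun p _ => ?_⟩
  set b := Module.finBasis 𝕜 E with hb
  set ψ : Fin (Module.finrank 𝕜 E) → E →L[𝕜] 𝕜 := fun i =>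
    LinearMap.toContinuousLinearMap (b.coord i) with hψ
  have hψ_apply : ∀ i x, ψ i x = b.repr x i := fun i x => rfl
  set q : Seminorm 𝕜 E := ∑ i, (normSeminorm 𝕜 𝕜).comp (ψ i).toLinearMap with hq
  have hq_apply : ∀ x, q x = ∑ i, ‖ψ i x‖ := fun x => by
    rw [hq, sum_apply]
    rfl
  have hqc : Continuous q := by
    rw [hq]
    refine Seminorm.continuous_finsetSum fun i _ => ?_
    change Continuous fun x => ‖ψ i x‖
    exact continuous_norm.comp (ψ i).continuous
  refine IsNuclearlyDominated.of_countable (α := Fin (Module.finrank 𝕜 E)) hqc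
    (fun i => ((p (b i) : ℝ) : 𝕜) • ψ i) (fun i => (⟨p (b i), apply_nonneg _ _⟩ : ℝ≥0))
    (hasSum_fintype _).summable (fun i x => ?_) fun x => ?_
  · rw [FunLike.coe_smul, Pi.smul_apply, norm_smul, RCLike.norm_ofReal,
      abs_of_nonneg (apply_nonneg _ _)]
    change p (b i) * ‖ψ i x‖ ≤ p (b i) * q x
    refine mul_le_mul_of_nonneg_left ?_ (apply_nonneg _ _)
    rw [hq_apply]
    exact Finset.single_le_sum (f := fun j => ‖ψ j x‖) (fun _ _ => norm_nonneg _)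
      (Finset.mem_univ i)
  · rw [tsum_fintype]
    have hx : x = ∑ i, b.repr x i • b i := (b.sum_repr x).symm
    calc p x = p (∑ i, b.repr x i • b i) := by rw [← hx]
      _ ≤ ∑ i, p (b.repr x i • b i) :=
          Finset.le_sum_of_subadditive p (map_zero p).le (fun a c => map_add_le_add p a c) _ _
      _ = ∑ i, ‖(((p (b i) : ℝ) : 𝕜) • ψ i) x‖ := Finset.sum_congr rfl fun i _ => by
          rw [map_smul_eq_mul, FunLike.coe_smul, Pi.smul_apply, norm_smul,
            RCLike.norm_ofReal, abs_of_nonneg (apply_nonneg _ _), hψ_apply, mul_comm]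

/-- Discharge of the named fact `Literature.Analysis.FunctionSpaces.NuclearSpace.prod`: **the product of two nuclear spaces is
nuclear.** For a continuous seminorm `p` on `E × F`, `p(x, y) ≤ p(x, 0) + p(0, y)`, and
`x ↦ p(x, 0)`, `y ↦ p(0, y)` are continuous seminorms on the nuclear factors, hence nuclearly
dominated; pull back along the projections and add. Pietsch 1972, Prop. 5.2.1; Trèves 1967,
Prop. 50.1. [cite: Pietsch1972, Prop. 5.2.1] -/
theorem prod_holds : NuclearSpace.prod (𝕜 := 𝕜) (E := E) := by
  intro F _ _ _ _ _
  refine ⟨fun p hp => ?_⟩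
  have h1 : IsNuclearlyDominated
      ((p.comp (ContinuousLinearMap.inl 𝕜 E F).toLinearMap).comp
        (ContinuousLinearMap.fst 𝕜 E F).toLinearMap) :=
    (NuclearSpace.isNuclearlyDominated _ (by
      rw [Seminorm.coe_comp]
      exact hp.comp (ContinuousLinearMap.inl 𝕜 E F).continuous)).comp _
  have h2 : IsNuclearlyDominated
      ((p.comp (ContinuousLinearMap.inr 𝕜 E F).toLinearMap).comp
        (ContinuousLinearMap.snd 𝕜 E F).toLinearMap) :=
    (NuclearSpace.isNuclearlyDominated _ (by
      rw [Seminorm.coe_comp]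
      exact hp.comp (ContinuousLinearMap.inr 𝕜 E F).continuous)).comp _
  refine (h1.add h2).mono fun x => ?_
  rw [add_apply, Seminorm.comp_apply, Seminorm.comp_apply, Seminorm.comp_apply,
    Seminorm.comp_apply]
  calc p x = p ((ContinuousLinearMap.inl 𝕜 E F) x.1 + (ContinuousLinearMap.inr 𝕜 E F) x.2) := by
        simp
    _ ≤ p ((ContinuousLinearMap.inl 𝕜 E F) x.1) + p ((ContinuousLinearMap.inr 𝕜 E F) x.2) :=
        map_add_le_add p _ _
    _ = _ := rfl

/-- Discharge of the named fact `Literature.Analysis.FunctionSpaces.not_nuclearSpace_of_not_finiteDimensional`: **an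
infinite-dimensional normed space is not nuclear.** If the norm were dominated by a nuclear
seminorm, `‖x‖ ≤ ∑ₙ |φₙ(x)|` with `|φₙ(x)| ≤ cₙ q(x) ≤ cₙ M ‖x‖` (`q` continuous,
`Seminorm.bound_of_continuous_normedSpace`) and `∑ cₙ < ∞`, then for `N` with
`M ∑_{n ≥ N} cₙ ≤ ½` we get `‖x‖ ≤ 2 ∑_{n < N} |φₙ(x)|`, so the linear map `x ↦ (φₙ(x))_{n < N}`
into `𝕜^N` is injective and `E` is finite dimensional. Trèves 1967, Cor. 2 of Prop. 50.2;
Pietsch 1972, Thm. 4.4.14. [cite: Treves1967, Cor. 2 of Prop. 50.2] [cite: Pietsch1972, Thm. 4.4.14] -/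
theorem _root_.Literature.Analysis.FunctionSpaces.not_nuclearSpace_of_not_finiteDimensional_holds :
    not_nuclearSpace_of_not_finiteDimensional := by
  intro 𝕜 E _ _ _ hE hN
  apply hE
  -- domination of the norm by a nuclear seminorm
  obtain ⟨q, hq, φ, c, hc, hφ, hsum, hp⟩ :=
    NuclearSpace.exists_dominating (𝕜 := 𝕜) (normSeminorm 𝕜 E) continuous_norm
  obtain ⟨M, hM, hqM⟩ := q.bound_of_continuous_normedSpace hq
  -- choose the cut-off `N`
  have htail : Filter.Tendsto (fun N : ℕ => M * ∑' n, (c (n + N) : ℝ)) Filter.atTop (nhds 0) := by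
    have := (tendsto_sum_nat_add fun n => (c n : ℝ)).const_mul M
    rwa [mul_zero] at this
  obtain ⟨N, hN⟩ := (htail.eventually (gt_mem_nhds (show (0 : ℝ) < 1 / 2 by norm_num))).exists
  -- the key estimate `‖x‖ ≤ 2 ∑_{n < N} ‖φ n x‖`
  have hkey : ∀ x : E, ‖x‖ ≤ 2 * ∑ n ∈ Finset.range N, ‖φ n x‖ := by
    intro x
    have hc' : Summable fun n => c (n + N) := (NNReal.summable_nat_add_iff N).2 hc
    have h1 : ‖x‖ ≤ ∑' n, ‖φ n x‖ := by simpa using hp x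
    have h2 : ∑' n, ‖φ n x‖ = ∑ n ∈ Finset.range N, ‖φ n x‖ + ∑' n, ‖φ (n + N) x‖ :=
      ((hsum x).sum_add_tsum_nat_add N).symm
    have h3 : ∑' n, ‖φ (n + N) x‖ ≤ (∑' n, (c (n + N) : ℝ)) * q x :=
      IsNuclearlyDominated.tsum_norm_apply_le (φ := fun n => φ (n + N)) hc'
        (fun n y => hφ (n + N) y) x
    have h4 : (∑' n, (c (n + N) : ℝ)) * q x ≤ (1 / 2) * ‖x‖ := by
      calc (∑' n, (c (n + N) : ℝ)) * q x ≤ (∑' n, (c (n + N) : ℝ)) * (M * ‖x‖) :=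
            mul_le_mul_of_nonneg_left (hqM x) (tsum_nonneg fun n => (c (n + N)).2)
        _ = (M * ∑' n, (c (n + N) : ℝ)) * ‖x‖ := by ring
        _ ≤ (1 / 2) * ‖x‖ := mul_le_mul_of_nonneg_right hN.le (norm_nonneg _)
    linarith
  -- the injective linear map into `𝕜^N`
  set T : E →ₗ[𝕜] (Fin N → 𝕜) :=
    { toFun := fun x i => φ i x
      map_add' := fun x y => funext fun i => by simp
      map_smul' := fun a x => funext fun i => by simp } with hT
  have hTinj : Function.Injective T := by
    intro x y hxy
    have h0 : ∀ i : Fin N, φ i (x - y) = 0 := fun i => by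
      have := congrFun hxy i
      simp only [hT, LinearMap.coe_mk, AddHom.coe_mk] at this
      rw [map_sub, this, sub_self]
    have hsum0 : ∑ n ∈ Finset.range N, ‖φ n (x - y)‖ = 0 :=
      Finset.sum_eq_zero fun n hn => by
        rw [h0 ⟨n, Finset.mem_range.1 hn⟩, norm_zero]
    have := hkey (x - y)
    rw [hsum0, mul_zero] at this
    exact sub_eq_zero.1 (norm_le_zero_iff.1 this)
  exact FiniteDimensional.of_injective T hTinj

/-! ### Subspaces (Pietsch 1972, Prop. 5.1.1) -/

section Subspace

open scoped ComplexOrder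

/-- For `𝕜 = ℝ` or `ℂ`, a topological `𝕜`-module which is locally convex for its real structure
is locally convex over `𝕜` in Mathlib's ordered-scalar sense (`RCLike 𝕜` with the `ComplexOrder`
partial order), because a set is `𝕜`-convex iff it is `ℝ`-convex
(`convex_RCLike_iff_convex_real`). This bridges the hypothesis `LocallyConvexSpace ℝ E` of the
named facts of `NuclearSpace.lean` to Mathlib's `LocallyConvexSpace.toPolynormableSpace`.
[folklore] -/
theorem _root_.Literature.Analysis.FunctionSpaces.locallyConvexSpace_rclike_of_real [Module ℝ E]
    [IsScalarTower ℝ 𝕜 E] [LocallyConvexSpace ℝ E] : LocallyConvexSpace 𝕜 E :=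
  ⟨fun x => (LocallyConvexSpace.convex_basis (𝕜 := ℝ) x).to_hasBasis
    (fun s hs => ⟨s, ⟨hs.1, convex_RCLike_iff_convex_real.mpr hs.2⟩, subset_rfl⟩)
    (fun s hs => ⟨s, ⟨hs.1, convex_RCLike_iff_convex_real.mp hs.2⟩, subset_rfl⟩)⟩

/-- Discharge of the named fact `Literature.Analysis.FunctionSpaces.NuclearSpace.of_closed_submodule`:
**every linear subspace of a locally convex nuclear space is nuclear** for the induced topology
(Pietsch 1972, Prop. 5.1.1, stated there for arbitrary linear subspaces; as in the source,
closedness of the subspace is not used). Pietsch's proof: the traces `F ∩ U` of the zero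
neighbourhoods `U` of `E` form a fundamental system of `F` with `p_{F ∩ U} = p_U|_F`, and the
restriction of a quasinuclear canonical map `E(V) → E(U)` to `F(V ∩ F)` is quasinuclear. In the
seminorm form (Q) of Prop. 4.1.4 this reads: `E` being locally convex is polynormable over `𝕜`
(`LocallyConvexSpace.toPolynormableSpace`), so a continuous seminorm `p` of the subspace `S` is
bounded by the restriction of a continuous seminorm `P` of `E`
(`Seminorm.exists_le_comp_of_isInducing`); a nuclear domination `P ≤ ∑ₙ |φₙ|`,
`|φₙ| ≤ cₙ Q`, `∑ cₙ < ∞` on `E` restricts to one of `p` on `S` (`IsNuclearlyDominated.comp`,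
`IsNuclearlyDominated.mono`). [cite: Pietsch1972, Prop. 5.1.1] -/
theorem of_closed_submodule_holds : of_closed_submodule (𝕜 := 𝕜) (E := E) := by
  intro _ _ _ _ _ _ S _
  haveI : ContinuousSMul ℝ E := IsScalarTower.continuousSMul (M := ℝ) (α := E) 𝕜
  haveI : LocallyConvexSpace 𝕜 E := locallyConvexSpace_rclike_of_real
  refine ⟨fun p hp => ?_⟩
  -- a continuous seminorm of `S` is bounded by the restriction of a continuous seminorm of `E`
  obtain ⟨P, hP, hpP⟩ :=
    Seminorm.exists_le_comp_of_isInducing (f := S.subtype) hp S.isEmbedding_subtype.isInducing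
  -- restrict a nuclear domination of `P` along the inclusion `S →L[𝕜] E`
  exact ((NuclearSpace.isNuclearlyDominated P hP).comp S.subtypeL).mono hpP

end Subspace

end NuclearSpace

end Literature.Analysis.FunctionSpaces
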